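import Summits.BirchSwinnertonDyer.BirchSwinnertonDyer.Theorems.SemiOrdinaryEisensteinDescentEisensteinKernelAtThree
import Summits.BirchSwinnertonDyer.BirchSwinnertonDyer.Theorems.SemiOrdinaryEisensteinDescentWildKolyvaginUpperAtThreeOfSigma
import Summits.BirchSwinnertonDyer.BirchSwinnertonDyer.Theorems.WildThreeRankOneBSDpOfGlobalDivisibility
import Literature.NumberTheory.EllipticCurves.KolyvaginShaStructureCertificate
import Summits.BirchSwinnertonDyer.BirchSwinnertonDyer.Theorems.AdditiveWildRankOneTowerSurjOfKato
import HarnessLib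

/-!
# Route `SemiOrdinaryEisensteinDescent` (SOED), crux #2′ `WildSplitEisensteinInclusionAtThreeRestricted`
# (stmt-BirchSwinnertonDyer-24155): the CERTIFICATE ROAD — STEP L at slack `s` from McCallum's Cor. 5.6 LOWER
# form BY NAME (Literature fact `McCallum1991_pow_dvd_card_sha_primary_of_certificate`) + ONE level-`(t+s+1)`
# certificate in POINT currency, and the whole leaf from the refined Kolyvagin conjecture at the additive `3`
# (cell `pub/bsd-wall`, width seat `bsd-wall-soed-p1-w3` g5, `--supports 24155`, helper; no definition, no named
# fact minted, no `sorry`)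

Sequel of `…WildSplitEisensteinInclusionAtThreeIndivisibilityRoad.lean` (p592658, this seat): there the LOWER
socket the kernel takes from `E′ ∧ #4 ∧ #5` was produced from the O5/O6 cell's class-currency SHAPE
`AdditiveThree.OneClassLowerBoundShape`. Here the structure-theorem input is the tree's LITERATURE fact for
McCallum 1991 Cor. 5.6 in its certificate (lower) form — `McCallum1991_pow_dvd_card_sha_primary_of_certificate`
(`KolyvaginShaStructureCertificate.lean`; the fact route `KolyvaginRoadThree`'s A1 kernel consumes at `3 ∥ N`) —
and the research input is ONE CERTIFICATE in the POINT currency of the route's own crux J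
(`WildSigmaDivisibilityAtThree`: `Koly.PDiv d 3 s′`): a square-free `n` of Kolyvagin primes of index
`≥ t + s + 1` and a Kolyvagin–Heegner datum `d` of conductor `n` on the frame `(Dt, H.β, ι)` whose derived point
`P_n` is NOT `3^{t+s+1}`-divisible in `E(K[n])`, `t = ord₃ ∏_ℓ c_ℓ(E)`, `s = v₃(c(Dt))`. This is the exact
mirror of utd-p3's UPPER receptacle `SchneiderFree.Exact.upper_of_globalDivisibility` (p542530-series,
`WildThreeRankOneBSDpOfGlobalDivisibility.lean` §2), whose bridges (conductor-`1` datum, bottom point, `p^{M₀} ∥ P`,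
`ord_p[E(K):ℤP] = M₀`, `ord_p #Ш = ord_p #Ш[p^∞]`) are reused verbatim.

## What is proved

* §1 (generic odd `p`, route-free content) **`lower_of_certificate`**: Kolyvagin (named, ∀-fact) + McCallum
  Cor. 5.6 lower form (named) + `p`-adic tower surjectivity + a Heegner datum `(Dt, H, ι, P = y_K)` of infinite
  order over `K` (`d_K ∉ {−3, −4}`) + ONE level-`(t+s+1)` certificate ⟹ `SchneiderFree.IndexLowerBoundLeAt W p K P s`.
* §2 (`p = 3`) **`wAllExclAddWildRankOneSurj_of_certificate`** — THE CERTIFICATE ROAD to SOED's leaf: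
  `PublishedInputsWildThree → McCallum (lower, named) → [CERT₃: a certificate at every tower-onto datum of the
  cell, displayed] → WildKolyvaginUpperAtThree → WildRankZeroTwistAtThree → WildRankOneSurjNonTowerAtThree →
  WAllExclAddWildRankOneSurj`. No `p`-adic `L`-function, no main conjecture, no control theorem, no frame.
* §3 **`wAllExclAddWildRankOneSurj_of_refinedKolyvagin`** — the leaf from the REFINED KOLYVAGIN CONJECTURE AT THE
  ADDITIVE `3` (both halves, Manin-robust, point currency) + print + the two residuals: `PublishedInputsWildThree →
  McCallum (lower) → KolyvaginStructureInputsAtThree (Kolyvagin ∧ Matar–Nekovář, the route's support #302 BY NAME)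
  → CERT₃ (indivisibility half) → WildSigmaDivisibilityAtThree (crux J = divisibility half, BY NAME) →
  WildRankZeroTwistAtThree → WildRankOneSurjNonTowerAtThree → WAllExclAddWildRankOneSurj` — §2 composed with the
  route's proved glue `wildKolyvaginUpperAtThreeOfSigma_proof` (p544141 receptacle). READING: on the tower-onto
  wild rank-one row, SOED ∖ {Eisenstein side} ∪ {CERT₃} = «`M_∞ = ord₃(c·∏c_ℓ)`» + print + residuals #6/#7.

HONEST STATUS: a ROAD; CERT₃ is research-open class-wide (no BD-admissible primes at `3`: Zhang / BCGS do not
apply) though decidable pair by pair by a finite computation (Jetchev–Lauter–Stein 2009 §4); the McCallum fact is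
PRINT keyed to a `p`-adic image hypothesis stronger than print (tower); every crux is an antecedent; `E′` is
neither used nor claimed false; BSD is not proved for any curve. Supports, does not close, stmt-BirchSwinnertonDyer-24155.

References: [McCallumLMS1991] §4 `S_r(M)` (pp. 299–300), §5 Lemma 5.1 (p. 303), Thm. 5.4 (p. 308), Cor. 5.6
(p. 310); [Kolyvagin1990] Thm. A; [MatarNekovar2019] Thm. 0.7, §0.11; [WZhang2014] Thm. 1.1, §3.8, Remark 18;
[Jetchev2008] Conj. 1.3, Thm. 1.4, Cor. 1.5; [BurungaleEtAl2026] Thm. 2 (arXiv:2312.09301);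
[JetchevLauterStein2009] Prop. 4.1–4.2 (arXiv:0707.0032); [JetchevSkinnerWan2017] §7.4.1 (arXiv:1512.06894
p. 30); [GrossZagier1986] Thm. I.(6.3), V.§2; [FriedbergHoffstein1995] Thm. B; [GrossLMS1991] §4 (4.1),
Lemma 4.3; [Darmon2004] Thm. 3.6–3.7.
-/

noncomputable section

open scoped Classical

set_option linter.dupNamespace false -- `Summit.BirchSwinnertonDyer.BirchSwinnertonDyer.Theorems.…` (summit = sub)
set_option autoImplicit false

namespace Summit.BirchSwinnertonDyer.BirchSwinnertonDyer.Theorems.WildSplitEisensteinInclusionAtThreeCertificateRoad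

open WeierstrassCurve NumberField IsDedekindDomain Field
  Literature.NumberTheory.EllipticCurves
  Literature.NumberTheory.EllipticCurves.ModularForms
  Literature.NumberTheory.EllipticCurves.Rank1Residual
  Literature.NumberTheory.EllipticCurves.KrizLi2019
  Summit.BirchSwinnertonDyer.Rank1Residual
  Summit.BirchSwinnertonDyer.Rank1Residual.Additive
  Summit.BirchSwinnertonDyer.Rank1Residual.X11b
  Summit.BirchSwinnertonDyer.Rank1Residual.X11b.Three
  Summit.BirchSwinnertonDyer.BirchSwinnertonDyer.Theses.SemiOrdinaryEisensteinDescent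
  Summit.BirchSwinnertonDyer.BirchSwinnertonDyer.Theorems

/-! ### §1 STEP L at slack `s` from McCallum's Cor. 5.6 (lower form, named) and ONE certificate (generic odd `p`) -/

/-- **THE LOWER RECEPTACLE — STEP L at slack `s` from ONE level-`(t+s+1)` certificate** (mirror of
`SchneiderFree.Exact.upper_of_globalDivisibility`). For `W/ℚ` globally minimal with `ρ_{E,p^n}` onto for all
`n` (`p` odd), `K` imaginary quadratic Heegner for `N_E` with `d_K ∉ {−3, −4}`, a datum `(Dt, H, ι)` at level
`N_E` and `P ∈ E(K)` with `ι(P) = heegnerPointComplex Dt H` of infinite order: IF McCallum 1991 Cor. 5.6 holds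
in its certificate form (`hMcL`, named Literature fact, hypothesis) and there is a square-free `n` all of whose
prime factors are Kolyvagin primes of index `≥ t + s + 1` (`t = ord_p ∏_ℓ c_ℓ(E)`) with a Kolyvagin–Heegner
datum `d` of conductor `n` on the frame `(Dt, H.β, ι)` whose derived point `P_n` is NOT `p^{t+s+1}`-divisible in
`E(K[n])` (`¬ Koly.PDiv d p (t+s+1)`), THEN `SchneiderFree.IndexLowerBoundLeAt W p K P s`, i.e.
`2·ord_p[E(K):ℤP] ≤ ord_p #Ш(E/K) + 2t + 2s`. Kernel steps (utd-p3's, reused): non-CM (onto mod `p`);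
rank one and `Ш(E/K)` finite (`kolyvagin`, hypothesis); the conductor-`1` datum exists (Darmon Thm. 3.6, tree
theorem) with bottom point `P` (Shimura reciprocity, tree theorem); `p^{M₀} ∥ P`; `ord_p[E(K):ℤP] = M₀`
(McCallum Lemma 5.1, `E(K)[p] = 0`); `ord_p #Ш = ord_p #Ш[p^∞]`; the fact gives `p^{2(M₀ − (t+s))} ∣ #Ш[p^∞]`.
[cite: McCallumLMS1991, §5 Cor. 5.6 (p. 310), Lemma 5.1 (p. 303), §4 S_r(M) (pp. 299–300)]
[cite: GrossLMS1991, §4 (4.1) and Lemma 4.3] [cite: Darmon2004, Thm. 3.6–3.7] -/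
theorem lower_of_certificate
    (hKo : ∀ (N : ℕ) [NeZero N] (W : WeierstrassCurve ℚ) (K : Type) [Field K] [NumberField K],
      kolyvagin N W K)
    (hMcL : McCallum1991_pow_dvd_card_sha_primary_of_certificate)
    (W : WeierstrassCurve ℚ) [W.IsElliptic] [W.IsGloballyMinimal] [NeZero (W.conductorNorm ℤ)]
    (p : ℕ) [Fact p.Prime] (hp2 : p ≠ 2) (hρ : ∀ n : ℕ, W.HasSurjectiveModNGaloisRep (p ^ n : ℕ))
    (K : Type) [Field K] [NumberField K] (hK : IsImaginaryQuadratic K)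
    (h3 : NumberField.discr K ≠ -3) (h4 : NumberField.discr K ≠ -4)
    (hHH : SatisfiesHeegnerHypothesis (W.conductorNorm ℤ) K)
    (Dt : ModularParametrizationData W (W.conductorNorm ℤ))
    (H : HeegnerDatum (W.conductorNorm ℤ) (NumberField.discr K)) (ι : K →+* ℂ)
    (P : (W.baseChange K).toAffine.Point)
    (hP : WeierstrassCurve.Affine.Point.map ι.toRatAlgHom P = heegnerPointComplex Dt H)
    (hnt : ¬ IsOfFinAddOrder P) (s : ℕ) {n : ℕ} (d : KolyvaginHeegnerData Dt H.β ι n) (hn : Squarefree n)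
    (hℓ : ∀ ℓ ∈ n.primeFactors, Zhang2014.IsKolyvaginPrime (W.conductorNorm ℤ) W K p ℓ ∧
      padicValNat p W.tamagawaProduct + s + 1 ≤ Zhang2014.kolyvaginIndex W p ℓ)
    (hcert : ¬ Koly.PDiv d p (padicValNat p W.tamagawaProduct + s + 1)) :
    SchneiderFree.IndexLowerBoundLeAt W p K P s := by
  have hp : p.Prime := Fact.out
  -- mod-`p` image onto, hence irreducible and non-CM
  have hsurj : W.HasSurjectiveModNGaloisRep p := by simpa using hρ 1
  have hCM : ¬ W.HasCM := fun hCM ↦ W.not_hasSurjectiveModNGaloisRep_of_hasCM hCM hp hp2 hsurj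
  haveI : NeZero ((p : ℕ) : ℚ) := ⟨by exact_mod_cast hp.ne_zero⟩
  have hirr : W.HasIrreducibleModPGaloisRep p :=
    hasIrreducibleModPGaloisRep_of_hasSurjectiveModNGaloisRep W p hsurj
  -- rank one and `Ш(E/K)` finite (Kolyvagin)
  obtain ⟨hrank, hfin⟩ := hKo (W.conductorNorm ℤ) W K hK hHH ⟨Dt, H, ι, hP⟩ hnt
  haveI : Finite (W.baseChange K).sha := hfin
  -- no `p`-torsion in `E(K)`
  have hbot := torsionBy_eq_bot_of_isImaginaryQuadratic_of_hasIrreducibleModPGaloisRep W K hK hp hirr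
  have hiv : ∀ x : (W.baseChange K).toAffine.Point, p • x = 0 → x = 0 := fun x hx ↦ by
    have hmem : x ∈ AddSubgroup.torsionBy (W.baseChange K).toAffine.Point ((p : ℕ) : ℤ) := by
      rw [mem_torsionBy_iff, natCast_zsmul]
      exact hx
    rw [hbot] at hmem
    exact hmem
  -- the conductor-`1` Kolyvagin–Heegner datum on the frame `(Dt, H.β, ι)` (Darmon 2004, Thm. 3.6)
  obtain ⟨d₁⟩ := exists_kolyvaginHeegnerData_one
    (phi_heegnerTau_mem_singularModuliField_holds (W.conductorNorm ℤ) W K) hK Dt H.β ι H.dvd_sq_sub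
  -- its bottom point is `P` in `E(K̄)` (Shimura reciprocity at conductor `1`)
  have hPd : d₁.toGeomPoints d₁.derivedPoint = toGeomPoints (W.baseChange K) P :=
    KolyvaginBottom.toGeomPoints_derivedPoint_one_eq
      (heegnerPointOfConductor_one_galoisConj_holds (W.conductorNorm ℤ) W K) hK hHH hP d₁ rfl
  -- `p^{M₀} ∥ P` (Mordell–Weil)
  haveI : Module.Finite ℤ (W.baseChange K).toAffine.Point := (W.baseChange K).module_finite_point_holds
  obtain ⟨M₀, x₀, hx₀, hmax⟩ := exists_pow_smul_eq_and_forall_ne hnt (p := p) hp.two_le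
  have hdiv : ∃ Q : (W.baseChange K).toAffine.Point, ((p ^ M₀ : ℕ) : ℤ) • Q = P :=
    ⟨x₀, by rw [natCast_zsmul]; exact hx₀⟩
  have hndiv : ¬ ∃ Q : (W.baseChange K).toAffine.Point, ((p ^ (M₀ + 1) : ℕ) : ℤ) • Q = P := by
    rintro ⟨Q, hQ⟩
    exact hmax Q (by rw [← natCast_zsmul]; exact hQ)
  -- McCallum's Cor. 5.6, certificate (lower) form, at level `t + s + 1`
  have hcert' : ¬ ∃ Q : (W.baseChange (ringClassField K ι n)).toAffine.Point,
      ((p ^ (padicValNat p W.tamagawaProduct + s + 1) : ℕ) : ℤ) • Q = d.derivedPoint := hcert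
  have hle : 2 * (M₀ - (padicValNat p W.tamagawaProduct + s)) ≤
      padicValNat p (Nat.card (AddCommGroup.primaryComponent (W.baseChange K).sha p)) :=
    two_mul_sub_le_padicValNat_card_sha_primary_of_certificate hMcL W hCM K hK h3 h4 hHH p hp2 hρ Dt H.β ι
      d₁ P hPd hnt hdiv hndiv d hn hℓ hcert'
  -- `ord_p #Ш = ord_p #Ш[p^∞]` and `ord_p [E(K):ℤP] = M₀`
  have hsha : padicValNat p (W.baseChange K).shaOrder =
      padicValNat p (Nat.card (AddCommGroup.primaryComponent (W.baseChange K).sha p)) :=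
    Koly.padicValNat_shaOrder_eq (W.baseChange K) p
  haveI : Finite (AddCommGroup.torsion (W.baseChange K).toAffine.Point) :=
    WeierstrassCurve.finite_torsion_point (W := W.baseChange K)
  obtain ⟨c, Q, hcQ, hcker⟩ := RankOne.exists_coord_of_mordellWeilRank_eq_one (W.baseChange K) hrank
  have hidx : padicValNat p (AddSubgroup.zmultiples P).index = M₀ :=
    Koly.padicValNat_index_zmultiples_eq_of_divisibility c Q hcQ hcker hiv P hdiv hndiv
  unfold SchneiderFree.IndexLowerBoundLeAt
  rw [hidx, hsha]
  omega

/-! ### §2 THE CERTIFICATE ROAD to SOED's leaf (`p = 3`) -/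

/-- **The SOED leaf by the CERTIFICATE ROAD.** Hypotheses: the route's published inputs `PublishedInputsWildThree`
(Kolyvagin's finiteness is among them); McCallum 1991 Cor. 5.6 in certificate form (`hMcL`, named Literature fact);
`hCert` = CERT₃, displayed (for `W` on `ClassO6 W 3`, `ρ̄_{E,3}` onto, `r_an = 1`, every Heegner `K` for `N_E` with
`L(E^{(d_K)},1) ≠ 0`, `d_K` odd, `≠ −3`, the datum `(Dt, H, ι)` at level `N_E`, `P = y_K` of infinite order, under
`3`-adic tower surjectivity: THERE IS a square-free `n` of Kolyvagin primes of index `≥ ord₃∏c_ℓ + v₃(c) + 1` and a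
Kolyvagin–Heegner datum `d` of conductor `n` on `(Dt, H.β, ι)` with `P_n ∉ 3^{ord₃∏c_ℓ + v₃(c) + 1} E(K[n])` —
«`M_∞ ≤ ord₃(c·∏c_ℓ)`» in point currency); cruxes #3 `WildKolyvaginUpperAtThree`, #6 `WildRankZeroTwistAtThree`,
#7 `WildRankOneSurjNonTowerAtThree`. Conclusion: the leaf `WAllExclAddWildRankOneSurj`. Proof: p588074's kernel
steps (o), (a), (c) verbatim; the lower socket from §1 (the `3`-adic tower binder read at every level by kmc's
`forall_hasSurjectiveModNGaloisRep_pow_three_of_towerSurjThree`). Every input is an antecedent; BSD is not proved by this.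
[cite: McCallumLMS1991, §5 Cor. 5.6 (p. 310)] [cite: WZhang2014, Thm. 1.1 and Remark 18]
[cite: JetchevSkinnerWan2017, §7.4.1 (arXiv:1512.06894 p. 30)] [cite: GrossZagier1986, Thm. I.(6.3) and V.§2]
[cite: FriedbergHoffstein1995, Thm. B] -/
theorem wAllExclAddWildRankOneSurj_of_certificate (hF : PublishedInputsWildThree)
    (hMcL : McCallum1991_pow_dvd_card_sha_primary_of_certificate)
    (hCert : ∀ (W : WeierstrassCurve ℚ) [W.IsElliptic] [W.IsGloballyMinimal] [NeZero (W.conductorNorm ℤ)]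
      (K : Type) [Field K] [NumberField K]
      (Dt : Literature.NumberTheory.EllipticCurves.ModularForms.ModularParametrizationData W (W.conductorNorm ℤ))
      (H : Literature.NumberTheory.EllipticCurves.HeegnerDatum (W.conductorNorm ℤ) (NumberField.discr K))
      (ι : K →+* ℂ) (P : (W.baseChange K).toAffine.Point),
      Summit.BirchSwinnertonDyer.Rank1Residual.Additive.ClassO6 W 3 → W.HasSurjectiveModNGaloisRep 3 →
      W.analyticRank = 1 → Literature.NumberTheory.EllipticCurves.IsImaginaryQuadratic K →
      Literature.NumberTheory.EllipticCurves.SatisfiesHeegnerHypothesis (W.conductorNorm ℤ) K →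
      (W.quadraticTwist (NumberField.discr K : ℚ)).entireLFunction 1 ≠ 0 →
      (WeierstrassCurve.Affine.Point.map ι.toRatAlgHom) P =
        Literature.NumberTheory.EllipticCurves.ModularForms.heegnerPointComplex Dt H →
      ¬ IsOfFinAddOrder P → Odd (NumberField.discr K) → NumberField.discr K ≠ -3 →
      Summit.BirchSwinnertonDyer.Rank1Residual.AdditiveThree.TowerSurjThree W →
      ∃ (n : ℕ) (d : Literature.NumberTheory.EllipticCurves.KolyvaginHeegnerData Dt H.β ι n),
        Squarefree n ∧
        (∀ ℓ ∈ n.primeFactors,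
          Literature.NumberTheory.EllipticCurves.Zhang2014.IsKolyvaginPrime (W.conductorNorm ℤ) W K 3 ℓ ∧
          padicValNat 3 W.tamagawaProduct + padicValNat 3 Dt.c.natAbs + 1 ≤
            Literature.NumberTheory.EllipticCurves.Zhang2014.kolyvaginIndex W 3 ℓ) ∧
        ¬ Summit.BirchSwinnertonDyer.Rank1Residual.X11b.Three.Koly.PDiv d 3
            (padicValNat 3 W.tamagawaProduct + padicValNat 3 Dt.c.natAbs + 1))
    (hKoly : WildKolyvaginUpperAtThree) (hZ : WildRankZeroTwistAtThree) (hNT : WildRankOneSurjNonTowerAtThree) :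
    Summit.BirchSwinnertonDyer.WAllExclAddWildRankOneSurj := by
  unfold Summit.BirchSwinnertonDyer.WAllExclAddWildRankOneSurj
  intro W _ _ hncm hO6 hsurj hr
  -- (o) TOWER SPLIT: off the tower-surjective rows the residual crux pays by name
  by_cases htower : AdditiveThree.TowerSurjThree W
  swap
  · exact hNT W hncm hO6 hsurj htower hr
  have hKv := hF.2.1
  obtain ⟨hGZ, hKo, hGZK, hmod, hmodP, -, hGZ73, hFH, hpar, hHP⟩ := hF
  haveI hN0 : NeZero (W.conductorNorm ℤ) := ⟨W.conductorNorm_pos_holds.ne'⟩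
  -- (a) DATA. parity: `r_an = 1` is odd, so `w(E) = -1`
  have hw : W.rootNumber = -1 := by
    rcases W.rootNumber_eq_one_or with h | h
    · exfalso
      have heven : Even W.analyticRank := (hpar W).mpr h
      rw [hr] at heven
      exact Nat.not_even_one heven
    · exact h
  -- Friedberg–Hoffstein with auxiliary modulus `2`: Heegner for `N(E)`, `2` split, `L(E^{(d_K)},1) ≠ 0`
  obtain ⟨K, _, _, hK, -, hHN, hH2, hLt⟩ := hFH W hw 2 two_ne_zero 0
  have hodd : Odd (NumberField.discr K) := by
    have h8 := Literature.SatisfiesHeegnerHypothesis.discr_emod_eight hK.1 hH2 (dvd_refl 2)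
    rw [Int.odd_iff]; omega
  have hd4 : NumberField.discr K ≠ -4 := by
    intro h
    have h2 := Int.odd_iff.mp hodd
    omega
  -- `3 ∣ N(E)` (additive) splits in `K`; hence `d_K ≠ -3`
  have h3N : 3 ∣ W.conductorNorm ℤ :=
    (W.dvd_conductorNorm_iff_not_hasGoodReductionAtPrime 3).mpr (not_good_of_addv W 3 hO6.2.1)
  have hd3 : NumberField.discr K ≠ -3 := by
    intro h
    exact Literature.SatisfiesHeegnerHypothesis.not_dvd_discr hK.1 hHN Nat.prime_three h3N
      (by rw [h]; norm_num)
  -- the Heegner point over `K` and its datum; non-torsion by Gross–Zagier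
  obtain ⟨P, Dt, H, ι, hP⟩ := hHP W K hK hHN
  have hL0 : W.entireLFunction 1 = 0 := entireLFunction_one_eq_zero_of_analyticRank_eq_one hr
  obtain ⟨-, hderiv⟩ := leadingLCoeff_eq_deriv_of_analyticRank_eq_one hr
  have hLK : LDerivEK W K ≠ 0 := by
    rw [lDerivEK_eq_deriv_mul W K hmod hL0]; exact mul_ne_zero hderiv hLt
  have hnt : ¬ IsOfFinAddOrder P :=
    (lDerivEK_ne_zero_iff_not_isOfFinAddOrder W (W.conductorNorm ℤ) K (hGZ _ W K) hK hHN
      ⟨Dt, H, ι, hP⟩).mp hLK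
  -- (b″) THE LOWER socket at slack `v₃(c)` from McCallum (lower form) + ONE certificate
  obtain ⟨n, d, hn, hℓ, hcert⟩ := hCert W K Dt H ι P hO6 hsurj hr hK hHN hLt hP hnt hodd hd3 htower
  have hlo : SchneiderFree.IndexLowerBoundLeAt W 3 K P (padicValNat 3 Dt.c.natAbs) :=
    lower_of_certificate hKv hMcL W 3 (by decide)
      (UniversalToricDescentWaldspurgerFlat.forall_hasSurjectiveModNGaloisRep_pow_three_of_towerSurjThree W htower)
      K hK hd3 hd4 hHN Dt H ι P hP hnt (padicValNat 3 Dt.c.natAbs) d hn hℓ hcert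
  -- the UPPER socket at slack `v₃(c)` IS the Kolyvagin crux (tower surjectivity, `d_K` odd, `≠ -3`)
  have hupI : SchneiderFree.Upper.IndexUpperBoundLeAt W 3 K P (padicValNat 3 Dt.c.natAbs) :=
    hKoly W (W.conductorNorm ℤ) K Dt H ι P hO6 hsurj hr rfl hK hHN hLt hP hnt hodd hd3 htower
  -- (c) TERMINAL STEP: a globally minimal model of the twist, then p528981
  have hD0 : (NumberField.discr K : ℚ) ≠ 0 := by exact_mod_cast NumberField.discr_ne_zero K
  haveI : (W.quadraticTwist (NumberField.discr K : ℚ)).IsElliptic := W.isElliptic_quadraticTwist hD0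
  obtain ⟨Cd, hCd⟩ := hasGlobalMinimalModel_rat_holds (W.quadraticTwist (NumberField.discr K : ℚ))
  haveI : (Cd • W.quadraticTwist (NumberField.discr K : ℚ)).IsGloballyMinimal := hCd
  exact SchneiderFree.Exact.bsdp_three_of_exactIndexManin_of_wAllExclAddWildRankZero hGZ hKo hGZK hmod
    hGZ73 hZ W hO6 hsurj hr (W.conductorNorm ℤ) K Dt H ι P
    (Cd • W.quadraticTwist (NumberField.discr K : ℚ)) rfl hK hodd hHN hLt hP ⟨Cd, rfl⟩ hlo hupI

/-! ### §3 The leaf from the REFINED KOLYVAGIN CONJECTURE at the additive `3` (both halves) + print + residuals -/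

/-- **SOED's leaf from «`M_∞ = ord₃(c·∏c_ℓ)`» at the additive `3`, kernel-certified.** Hypotheses:
`PublishedInputsWildThree`; McCallum Cor. 5.6 lower form (`hMcL`, named); the route's support
`KolyvaginStructureInputsAtThree` (Kolyvagin 1990 Thm. A ∧ Matar–Nekovář 2019 Thm. 0.7/§0.11, named, BY NAME);
CERT₃ (the INDIVISIBILITY half, displayed as in §2); the route's crux J `WildSigmaDivisibilityAtThree` (the
DIVISIBILITY half, BY NAME); the residual cruxes #6, #7. Conclusion: `WAllExclAddWildRankOneSurj`. Proof: §2 with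
crux #3 supplied by the route's proved glue `wildKolyvaginUpperAtThreeOfSigma_proof` (J → structure inputs → Ko,
p544141). So on the tower-onto wild rank-one row the route WITHOUT its Eisenstein side (#2′, #4, #5) is the
refined Kolyvagin conjecture at `3` in point currency + print + the two residuals. Every input is an antecedent;
nothing is claimed about J, CERT₃ or BSD. [cite: WZhang2014, Thm. 1.1, §3.8 and Remark 18]
[cite: Jetchev2008, Conj. 1.3 and Cor. 1.5 (p. 812)] [cite: McCallumLMS1991, §5 Cor. 5.6 (p. 310)]
[cite: MatarNekovar2019, Thm. 0.7 (p. 456) and §0.11 (p. 457)] -/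
theorem wAllExclAddWildRankOneSurj_of_refinedKolyvagin (hF : PublishedInputsWildThree)
    (hMcL : McCallum1991_pow_dvd_card_sha_primary_of_certificate) (hS : KolyvaginStructureInputsAtThree)
    (hCert : ∀ (W : WeierstrassCurve ℚ) [W.IsElliptic] [W.IsGloballyMinimal] [NeZero (W.conductorNorm ℤ)]
      (K : Type) [Field K] [NumberField K]
      (Dt : Literature.NumberTheory.EllipticCurves.ModularForms.ModularParametrizationData W (W.conductorNorm ℤ))
      (H : Literature.NumberTheory.EllipticCurves.HeegnerDatum (W.conductorNorm ℤ) (NumberField.discr K))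
      (ι : K →+* ℂ) (P : (W.baseChange K).toAffine.Point),
      Summit.BirchSwinnertonDyer.Rank1Residual.Additive.ClassO6 W 3 → W.HasSurjectiveModNGaloisRep 3 →
      W.analyticRank = 1 → Literature.NumberTheory.EllipticCurves.IsImaginaryQuadratic K →
      Literature.NumberTheory.EllipticCurves.SatisfiesHeegnerHypothesis (W.conductorNorm ℤ) K →
      (W.quadraticTwist (NumberField.discr K : ℚ)).entireLFunction 1 ≠ 0 →
      (WeierstrassCurve.Affine.Point.map ι.toRatAlgHom) P =
        Literature.NumberTheory.EllipticCurves.ModularForms.heegnerPointComplex Dt H →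
      ¬ IsOfFinAddOrder P → Odd (NumberField.discr K) → NumberField.discr K ≠ -3 →
      Summit.BirchSwinnertonDyer.Rank1Residual.AdditiveThree.TowerSurjThree W →
      ∃ (n : ℕ) (d : Literature.NumberTheory.EllipticCurves.KolyvaginHeegnerData Dt H.β ι n),
        Squarefree n ∧
        (∀ ℓ ∈ n.primeFactors,
          Literature.NumberTheory.EllipticCurves.Zhang2014.IsKolyvaginPrime (W.conductorNorm ℤ) W K 3 ℓ ∧
          padicValNat 3 W.tamagawaProduct + padicValNat 3 Dt.c.natAbs + 1 ≤
            Literature.NumberTheory.EllipticCurves.Zhang2014.kolyvaginIndex W 3 ℓ) ∧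
        ¬ Summit.BirchSwinnertonDyer.Rank1Residual.X11b.Three.Koly.PDiv d 3
            (padicValNat 3 W.tamagawaProduct + padicValNat 3 Dt.c.natAbs + 1))
    (hJ : WildSigmaDivisibilityAtThree) (hZ : WildRankZeroTwistAtThree) (hNT : WildRankOneSurjNonTowerAtThree) :
    Summit.BirchSwinnertonDyer.WAllExclAddWildRankOneSurj :=
  wAllExclAddWildRankOneSurj_of_certificate hF hMcL hCert (wildKolyvaginUpperAtThreeOfSigma_proof hJ hS) hZ hNT

end Summit.BirchSwinnertonDyer.BirchSwinnertonDyer.Theorems.WildSplitEisensteinInclusionAtThreeCertificateRoad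

end
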